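import Mathlib.Analysis.Fourier.FiniteAbelian.PontryaginDuality
import HarnessLib

/-!
# The two-sheet annihilator lemma: Fourier analysis on an abelian subgroup of index two

COR-CM (cell `pub-hodgecm2`), binder seat b04 (gen 20), count-neutral claim DICYCLIC-TWO-SHEET, part II.  Pure
finite-group harmonic analysis (Mathlib only): theorems, no definition, no named fact, no `sorry`.

By part I (`CorCM/GaloisRightTranslateRank`, the ANNIHILATOR CRITERION) a CM type of a Galois CM field `K`, read as
`S ⊆ G = Gal(K/ℚ)` with complex conjugation `c`, is NONDEGENERATE iff every `c`-antisymmetric weight `b : G → ℚ`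
with `Σ_{s∈S} b(s g) = 0` for all `g` vanishes.  For `G` ABELIAN, Fourier inversion turns this into Kubota's
Lemma 2 (no odd character vanishes on `S`).  Here `G ⊇ A` has an ABELIAN subgroup of INDEX TWO containing `c`
(`G = A ⊔ A x`, `x u x⁻¹ = θ(u)`, `x² = q ∈ A`): a weight `b` is a pair of SHEETS `α = b|_A`, `β = b(· x)|_A`, the
annihilator equations become the TWO-SHEET SYSTEM
  `(1) Σ_{s∈S₁} α(s u) + Σ_{t∈S₂} β(t θ(u)) = 0`, `(2) Σ_{s∈S₁} β(s θ(u)) + Σ_{t∈S₂} α(t q u) = 0` (`u ∈ A`),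
where `S = S₁ ⊔ S₂ x`, and its Fourier transform is, odd character by odd character, a `2 × 2` linear system for
`(α̂(χ), β̂(χ∘θ))` with DETERMINANT
  `Δ(χ) = Ŝ₁(χ) Ŝ₁(χ∘θ) − χ(q) Ŝ₂(χ) Ŝ₂(χ∘θ)`,  `Ŝ(χ) = Σ_{s∈S} χ(s)`.

* §1 `eq_zero_of_forall_character_sum_eq_zero` (Fourier inversion on a finite abelian group, from Mathlib's dual
  orthogonality `AddChar.sum_apply_eq_ite`); `eq_zero_of_antisymm_of_forall_odd` — an ANTISYMMETRIC function
  (`f(c u) = -f(u)`, `c² = 1`) with vanishing ODD Fourier coefficients (`χ(c) = -1`) is zero.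
* §2 `character_sum_shift`, `character_sum_twist` — `Σ_u χ(u⁻¹) g(s u) = χ(s) ĝ(χ)` and its `θ`-twisted form.
* §3 **`twoSheet_eq_zero`** — if `Δ(χ) ≠ 0` for every odd `χ`, every antisymmetric solution `(α, β)` of the
  two-sheet system is zero.
* §4 **`eq_zero_of_twoSheet`** — GROUP FORM: `i : A →* G` injective with image of index `2` (`G = i(A) ⊔ i(A) x`),
  `x i(u) = i(θ u) x`, `x² = i(q)`, `c ∈ A` with `c² = 1`, `θ c = c`; `S ⊆ G` with sheets `S₁ = i⁻¹ S`,
  `S₂ = {u | i(u) x ∈ S}`: if `Δ(χ) ≠ 0` for all odd `χ` then every `i(c)`-antisymmetric `b : G → ℚ` annihilated by the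
  right translates of `S` is zero — the input of part I's criterion.  (For `θ = ⁻¹`, `q = c`: `Δ = |Ŝ₁|² + |Ŝ₂|²`,
  part IV.)

## References

* [Kubota1965] T. Kubota, *On the field extension by complex multiplication*, Trans. AMS 118 (1965), §4 Lemma 2 (the
  one-sheet case: `rank = 1 + #{χ odd | Σ_S χ ≠ 0}`).
* [Dodson1987] B. Dodson, J. Algebra 111 (1987), §1.1 p. 50 (the rank via translates).
* [Gordon1999HodgeAVSurvey] B. B. Gordon, *A survey of the Hodge conjecture for abelian varieties*, Prop. 9.4.1.

Provenance: Literature home (family `hodge`, namespace `Literature.GroupTheory.TwoSheet`) of the Summits-side `CorCM/TwoSheetAnnihilator` (cell `pub-hodgecm2`, COR-CM; all its imports are `Literature/` and Mathlib), which `Literature/` may not import; theorems only, no named fact, no definition. Nothing here bears on `HC_CM`. Lane `lit-hodgefound` (Layer A3: CM types, their Kubota ranks and Galois combinatorics), seat p20.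
-/

noncomputable section

open scoped BigOperators

namespace Literature.GroupTheory.TwoSheet

open AddChar

variable {A : Type*} [CommGroup A] [Fintype A] [DecidableEq A]

/-! ## §1 Fourier inversion; antisymmetric functions are determined by their odd coefficients -/

/-- **Fourier inversion on a finite abelian group**: if `Σ_u f(u) χ(u⁻¹) = 0` for every character `χ` then `f = 0`
(dual orthogonality `Σ_χ χ(w) = |A| [w = 1]`). [cite: Kubota1965, §4 Lemma 2] -/
theorem eq_zero_of_forall_character_sum_eq_zero (f : A → ℂ)
    (h : ∀ χ : AddChar (Additive A) ℂ, ∑ u, f u * χ (Additive.ofMul u⁻¹) = 0) : f = 0 := by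
  classical
  funext v
  have hcard : (Fintype.card (Additive A) : ℂ) ≠ 0 := Nat.cast_ne_zero.2 Fintype.card_ne_zero
  have horth : ∀ u : A, ∑ χ : AddChar (Additive A) ℂ, χ (Additive.ofMul u⁻¹) * χ (Additive.ofMul v) =
      if u = v then (Fintype.card (Additive A) : ℂ) else 0 := fun u => by
    simp_rw [← map_add_eq_mul, ← ofMul_mul]
    rw [AddChar.sum_apply_eq_ite]
    by_cases huv : u = v
    · subst huv; simp
    · rw [if_neg huv, if_neg]
      rwa [ofMul_eq_zero, inv_mul_eq_one]
  have key : ∑ χ : AddChar (Additive A) ℂ, (∑ u, f u * χ (Additive.ofMul u⁻¹)) * χ (Additive.ofMul v) =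
      f v * Fintype.card (Additive A) := by
    simp_rw [Finset.sum_mul, mul_assoc]
    rw [Finset.sum_comm]
    simp_rw [← Finset.mul_sum, horth, mul_ite, mul_zero, Finset.sum_ite_eq', Finset.mem_univ, if_true]
  have hz : ∑ χ : AddChar (Additive A) ℂ, (∑ u, f u * χ (Additive.ofMul u⁻¹)) * χ (Additive.ofMul v) = 0 :=
    Finset.sum_eq_zero fun χ _ => by rw [h χ, zero_mul]
  rw [key] at hz
  simpa [hcard] using hz

omit [Fintype A] [DecidableEq A] in
/-- `χ(c) = ±1` when `c² = 1`. [cite: Kubota1965, §4 Lemma 2] -/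
theorem character_involution (χ : AddChar (Additive A) ℂ) {c : A} (hcc : c * c = 1) :
    χ (Additive.ofMul c) = 1 ∨ χ (Additive.ofMul c) = -1 := by
  have h2 : χ (Additive.ofMul c) * χ (Additive.ofMul c) = 1 := by
    rw [← map_add_eq_mul, ← ofMul_mul, hcc, ofMul_one, map_zero_eq_one]
  exact mul_self_eq_one_iff.1 h2

/-- **An antisymmetric function with vanishing odd Fourier coefficients is zero**: `c² = 1`, `f(c u) = -f(u)` for
all `u`, and `Σ_u f(u) χ(u⁻¹) = 0` for every ODD character (`χ(c) = -1`) force `f = 0` — the EVEN coefficients of an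
antisymmetric function vanish identically. [cite: Kubota1965, §4 Lemma 2] -/
theorem eq_zero_of_antisymm_of_forall_odd {c : A} (hcc : c * c = 1) (f : A → ℂ) (hf : ∀ u, f (c * u) = -f u)
    (h : ∀ χ : AddChar (Additive A) ℂ, χ (Additive.ofMul c) = -1 → ∑ u, f u * χ (Additive.ofMul u⁻¹) = 0) :
    f = 0 := by
  refine eq_zero_of_forall_character_sum_eq_zero f fun χ => ?_
  rcases character_involution χ hcc with hχ | hχ
  · -- even character: the coefficient is its own negative
    have hcinv : c⁻¹ = c := inv_eq_of_mul_eq_one_right hcc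
    have e1 : ∑ u, f u * χ (Additive.ofMul u⁻¹) = ∑ u, f (c * u) * χ (Additive.ofMul (c * u)⁻¹) :=
      (Fintype.sum_equiv (Equiv.mulLeft c) (fun u => f (c * u) * χ (Additive.ofMul (c * u)⁻¹))
        (fun u => f u * χ (Additive.ofMul u⁻¹)) fun _ => rfl).symm
    have e2 : ∀ u, f (c * u) * χ (Additive.ofMul (c * u)⁻¹) = -(f u * χ (Additive.ofMul u⁻¹)) := fun u => by
      rw [hf, mul_inv_rev, hcinv, ofMul_mul, map_add_eq_mul, hχ, mul_one, neg_mul]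
    simp_rw [e2, Finset.sum_neg_distrib] at e1
    linear_combination (1 / 2 : ℂ) * e1
  · exact h χ hχ

/-! ## §2 Shifted and twisted character sums -/

omit [DecidableEq A] in
/-- `Σ_u χ(u⁻¹) g(s u) = χ(s) · Σ_v χ(v⁻¹) g(v)`. [cite: Kubota1965, §4 Lemma 2] -/
theorem character_sum_shift (χ : AddChar (Additive A) ℂ) (g : A → ℂ) (s : A) :
    ∑ u, χ (Additive.ofMul u⁻¹) * g (s * u) = χ (Additive.ofMul s) * ∑ v, χ (Additive.ofMul v⁻¹) * g v := by
  have e1 : ∑ u, χ (Additive.ofMul u⁻¹) * g (s * u) = ∑ v, χ (Additive.ofMul (s⁻¹ * v)⁻¹) * g v := by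
    refine Fintype.sum_equiv (Equiv.mulLeft s) _ _ fun u => ?_
    simp only [Equiv.coe_mulLeft, inv_mul_cancel_left]
  rw [e1, Finset.mul_sum]
  refine Finset.sum_congr rfl fun v _ => ?_
  rw [mul_inv_rev, inv_inv, ofMul_mul, map_add_eq_mul]
  ring

omit [DecidableEq A] in
/-- The `θ`-twisted form: `Σ_u χ(u⁻¹) g(t θ(u)) = χ(θ t) · Σ_v χ((θ v)⁻¹) g(v)` for an involutive automorphism `θ`.
 [cite: Kubota1965, §4 Lemma 2] -/
theorem character_sum_twist (χ : AddChar (Additive A) ℂ) (θ : A ≃* A) (hθθ : ∀ u, θ (θ u) = u) (g : A → ℂ)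
    (t : A) : ∑ u, χ (Additive.ofMul u⁻¹) * g (t * θ u) =
      χ (Additive.ofMul (θ t)) * ∑ v, χ (Additive.ofMul (θ v)⁻¹) * g v := by
  -- substitute `u = θ u'`
  have e1 : ∑ u, χ (Additive.ofMul u⁻¹) * g (t * θ u) = ∑ u', χ (Additive.ofMul (θ u')⁻¹) * g (t * u') := by
    refine (Fintype.sum_equiv θ.toEquiv (fun u' => χ (Additive.ofMul (θ u')⁻¹) * g (t * u'))
      (fun u => χ (Additive.ofMul u⁻¹) * g (t * θ u)) fun u' => ?_).symm
    simp [hθθ]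
  -- the twisted character `χ ∘ θ`
  let χθ : AddChar (Additive A) ℂ := χ.compAddMonoidHom (MonoidHom.toAdditive θ.toMonoidHom)
  have hχθ : ∀ u : A, χθ (Additive.ofMul u) = χ (Additive.ofMul (θ u)) := fun u => rfl
  rw [e1]
  have e2 := character_sum_shift χθ g t
  simp only [hχθ, map_inv] at e2 ⊢
  exact e2

/-! ## §3 The two-sheet lemma -/

/-- **THE TWO-SHEET LEMMA.**  Data on a finite abelian group `A`: an involution `c` (`c² = 1`), an element `q`, an
involutive automorphism `θ` fixing `c`, finite sets `S₁, S₂`, and two `c`-ANTISYMMETRIC functions `α, β` solving the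
TWO-SHEET SYSTEM `Σ_{s∈S₁} α(s u) + Σ_{t∈S₂} β(t θ(u)) = 0`, `Σ_{s∈S₁} β(s θ(u)) + Σ_{t∈S₂} α(t q u) = 0` for all `u`.
If for every ODD character `χ` the determinant `Ŝ₁(χ) Ŝ₁(χθ) − χ(q) Ŝ₂(χ) Ŝ₂(χθ)` is non-zero, then `α = β = 0`.
(Fourier transform of the system: `Ŝ₁(χ) α̂ + Ŝ₂(χθ) β̂θ = 0`, `χ(q) Ŝ₂(χ) α̂ + Ŝ₁(χθ) β̂θ = 0`.)
[cite: Kubota1965, §4 Lemma 2] -/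
theorem twoSheet_eq_zero {c q : A} (hcc : c * c = 1) (θ : A ≃* A) (hθc : θ c = c) (hθθ : ∀ u, θ (θ u) = u)
    (S₁ S₂ : Finset A) (α β : A → ℂ) (hα : ∀ u, α (c * u) = -α u) (hβ : ∀ u, β (c * u) = -β u)
    (h1 : ∀ u, ∑ s ∈ S₁, α (s * u) + ∑ t ∈ S₂, β (t * θ u) = 0)
    (h2 : ∀ u, ∑ s ∈ S₁, β (s * θ u) + ∑ t ∈ S₂, α (t * (q * u)) = 0)
    (hdet : ∀ χ : AddChar (Additive A) ℂ, χ (Additive.ofMul c) = -1 →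
      (∑ s ∈ S₁, χ (Additive.ofMul s)) * (∑ s ∈ S₁, χ (Additive.ofMul (θ s))) -
        χ (Additive.ofMul q) * ((∑ t ∈ S₂, χ (Additive.ofMul t)) * (∑ t ∈ S₂, χ (Additive.ofMul (θ t)))) ≠ 0) :
    α = 0 ∧ β = 0 := by
  -- Fourier coefficients `X(χ) = Σ χ(v⁻¹) α(v)`, `Y(χ) = Σ χ((θ v)⁻¹) β(v)`
  have hsys : ∀ χ : AddChar (Additive A) ℂ, χ (Additive.ofMul c) = -1 →
      (∑ v, χ (Additive.ofMul v⁻¹) * α v) = 0 ∧ (∑ v, χ (Additive.ofMul (θ v)⁻¹) * β v) = 0 := by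
    intro χ hχ
    set X : ℂ := ∑ v, χ (Additive.ofMul v⁻¹) * α v with hX
    set Y : ℂ := ∑ v, χ (Additive.ofMul (θ v)⁻¹) * β v with hY
    set a : ℂ := ∑ s ∈ S₁, χ (Additive.ofMul s) with ha
    set aθ : ℂ := ∑ s ∈ S₁, χ (Additive.ofMul (θ s)) with haθ
    set d : ℂ := ∑ t ∈ S₂, χ (Additive.ofMul t) with hd
    set dθ : ℂ := ∑ t ∈ S₂, χ (Additive.ofMul (θ t)) with hdθ
    -- transform of (1): `a X + dθ Y = 0`
    have E1 : a * X + dθ * Y = 0 := by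
      have h := congrArg (fun F : A → ℂ => ∑ u, χ (Additive.ofMul u⁻¹) * F u) (funext h1)
      simp only [mul_zero, Finset.sum_const_zero, mul_add, Finset.sum_add_distrib, Finset.mul_sum] at h
      rw [Finset.sum_comm, Finset.sum_comm (s := Finset.univ) (t := S₂)] at h
      simp_rw [character_sum_shift χ α, character_sum_twist χ θ hθθ β] at h
      rw [← Finset.sum_mul, ← Finset.sum_mul] at h
      exact h
    -- transform of (2): `(χ q) d X + aθ Y = 0`
    have E2 : χ (Additive.ofMul q) * d * X + aθ * Y = 0 := by
      have h := congrArg (fun F : A → ℂ => ∑ u, χ (Additive.ofMul u⁻¹) * F u) (funext h2)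
      simp only [mul_zero, Finset.sum_const_zero, mul_add, Finset.sum_add_distrib, Finset.mul_sum] at h
      rw [Finset.sum_comm, Finset.sum_comm (s := Finset.univ) (t := S₂)] at h
      simp_rw [character_sum_twist χ θ hθθ β, ← mul_assoc _ q, character_sum_shift χ α, ofMul_mul,
        map_add_eq_mul] at h
      rw [← Finset.sum_mul, ← Finset.sum_mul] at h
      have hd' : ∑ t ∈ S₂, χ (Additive.ofMul t) * χ (Additive.ofMul q) = χ (Additive.ofMul q) * d := by
        rw [hd, Finset.mul_sum]
        exact Finset.sum_congr rfl fun t _ => mul_comm _ _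
      rw [hd'] at h
      linear_combination h
    have hΔ := hdet χ hχ
    constructor
    · -- `Δ X = aθ E1 - dθ E2`
      have : (a * aθ - χ (Additive.ofMul q) * (d * dθ)) * X = 0 := by
        linear_combination aθ * E1 - dθ * E2
      exact (mul_eq_zero.1 this).resolve_left hΔ
    · have : (a * aθ - χ (Additive.ofMul q) * (d * dθ)) * Y = 0 := by
        linear_combination a * E2 - χ (Additive.ofMul q) * d * E1
      exact (mul_eq_zero.1 this).resolve_left hΔ
  constructor
  · refine eq_zero_of_antisymm_of_forall_odd hcc α hα fun χ hχ => ?_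
    rw [← (hsys χ hχ).1]
    exact Finset.sum_congr rfl fun v _ => mul_comm _ _
  · refine eq_zero_of_antisymm_of_forall_odd hcc β hβ fun ψ hψ => ?_
    -- use the odd character `ψ ∘ θ`
    let ψθ : AddChar (Additive A) ℂ := ψ.compAddMonoidHom (MonoidHom.toAdditive θ.toMonoidHom)
    have hψθ : ∀ u : A, ψθ (Additive.ofMul u) = ψ (Additive.ofMul (θ u)) := fun u => rfl
    have hodd : ψθ (Additive.ofMul c) = -1 := by rw [hψθ, hθc, hψ]
    have h0 := (hsys ψθ hodd).2
    simp only [hψθ, map_inv, hθθ] at h0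
    rw [← h0]
    exact Finset.sum_congr rfl fun v _ => mul_comm _ _

/-! ## §4 Group form: an abelian subgroup of index two -/

section Group

variable {G : Type*} [Group G] [Fintype G] [DecidableEq G]

omit [Fintype A] [DecidableEq A] [Fintype G] [DecidableEq G] in
/-- `θ` is involutive: `x² = i(q)` centralises `i(A)` (`A` abelian). [cite: Kubota1965, §4 Lemma 2] -/
theorem twist_twist (i : A →* G) (hi : Function.Injective i) (x : G) (θ : A ≃* A)
    (hθ : ∀ u, x * i u = i (θ u) * x) (q : A) (hq : x * x = i q) (u : A) : θ (θ u) = u := by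
  have h1 : x * x * i u = i (θ (θ u)) * (x * x) := by
    rw [mul_assoc, hθ, ← mul_assoc, hθ, mul_assoc]
  rw [hq, ← map_mul, ← map_mul, mul_comm q] at h1
  exact (mul_right_cancel (hi h1)).symm

omit [DecidableEq A] [DecidableEq G] in
/-- **Sums over `S ⊆ G = i(A) ⊔ i(A) x` split into the two sheets.** [cite: Kubota1965, §4 Lemma 2] -/
theorem sum_eq_sum_sheets (i : A →* G) (hi : Function.Injective i) (x : G) (hx : ∀ u, i u ≠ x)
    (hcov : ∀ g : G, (∃ u, g = i u) ∨ (∃ u, g = i u * x)) (S : Finset G) (S₁ S₂ : Finset A)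
    (hS₁ : ∀ u, u ∈ S₁ ↔ i u ∈ S) (hS₂ : ∀ u, u ∈ S₂ ↔ i u * x ∈ S) {M : Type*} [AddCommMonoid M]
    (F : G → M) : ∑ s ∈ S, F s = ∑ u ∈ S₁, F (i u) + ∑ u ∈ S₂, F (i u * x) := by
  classical
  -- the bijection `A ⊕ A → G`
  let e : A ⊕ A → G := Sum.elim (fun u => i u) (fun u => i u * x)
  have hinj : Function.Injective e := by
    rintro (u | u) (v | v) h
    · exact congrArg Sum.inl (hi h)
    · exfalso
      refine hx (v⁻¹ * u) ?_
      change i u = i v * x at h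
      rw [map_mul, map_inv, h, inv_mul_cancel_left]
    · exfalso
      refine hx (u⁻¹ * v) ?_
      change i u * x = i v at h
      rw [map_mul, map_inv, ← h, inv_mul_cancel_left]
    · change i u * x = i v * x at h
      exact congrArg Sum.inr (hi (mul_right_cancel h))
  have hsurj : Function.Surjective e := fun g => by
    rcases hcov g with ⟨u, rfl⟩ | ⟨u, rfl⟩
    · exact ⟨Sum.inl u, rfl⟩
    · exact ⟨Sum.inr u, rfl⟩
  have h1 : ∑ s ∈ S, F s = ∑ g : G, if g ∈ S then F g else 0 := (Fintype.sum_ite_mem S F).symm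
  rw [h1, ← Fintype.sum_bijective e ⟨hinj, hsurj⟩ (fun p => if e p ∈ S then F (e p) else 0)
    (fun g => if g ∈ S then F g else 0) (fun _ => rfl), Fintype.sum_sum_type]
  simp only [e, Sum.elim_inl, Sum.elim_inr]
  simp_rw [← hS₁, ← hS₂]
  rw [Fintype.sum_ite_mem, Fintype.sum_ite_mem]

omit [DecidableEq G] in
/-- **THE TWO-SHEET ANNIHILATOR THEOREM (group form).**  `i : A →* G` injective from a finite abelian group with
image of index two (`G = i(A) ⊔ i(A) x`), `x i(u) = i(θ u) x`, `x² = i(q)`, `c ∈ A` with `c² = 1` and `θ c = c`;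
`S ⊆ G` with sheets `S₁ = {u | i u ∈ S}`, `S₂ = {u | i(u) x ∈ S}`.  If `Ŝ₁(χ)Ŝ₁(χθ) − χ(q)Ŝ₂(χ)Ŝ₂(χθ) ≠ 0` for every
odd character `χ` of `A`, then every `i(c)`-antisymmetric `b : G → ℚ` annihilated by all right translates of `S`
(`Σ_{s∈S} b(s g) = 0`) is zero. [cite: Kubota1965, §4 Lemma 2] [cite: Dodson1987, §1.1 (p. 50)] -/
theorem eq_zero_of_twoSheet (i : A →* G) (hi : Function.Injective i) (x : G) (hx : ∀ u, i u ≠ x)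
    (hcov : ∀ g : G, (∃ u, g = i u) ∨ (∃ u, g = i u * x)) (θ : A ≃* A) (hθ : ∀ u, x * i u = i (θ u) * x)
    (q : A) (hq : x * x = i q) {c : A} (hcc : c * c = 1) (hθc : θ c = c)
    (S : Finset G) (S₁ S₂ : Finset A) (hS₁ : ∀ u, u ∈ S₁ ↔ i u ∈ S) (hS₂ : ∀ u, u ∈ S₂ ↔ i u * x ∈ S)
    (hdet : ∀ χ : AddChar (Additive A) ℂ, χ (Additive.ofMul c) = -1 →
      (∑ s ∈ S₁, χ (Additive.ofMul s)) * (∑ s ∈ S₁, χ (Additive.ofMul (θ s))) -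
        χ (Additive.ofMul q) * ((∑ t ∈ S₂, χ (Additive.ofMul t)) * (∑ t ∈ S₂, χ (Additive.ofMul (θ t)))) ≠ 0)
    (b : G → ℚ) (hb : ∀ g, b (i c * g) = -b g) (hann : ∀ g : G, ∑ s ∈ S, b (s * g) = 0) : b = 0 := by
  have hθθ := twist_twist i hi x θ hθ q hq
  -- the two sheets of `b`
  set α : A → ℂ := fun u => (b (i u) : ℂ) with hα_def
  set β : A → ℂ := fun u => (b (i u * x) : ℂ) with hβ_def
  have hα : ∀ u, α (c * u) = -α u := fun u => by
    simp only [hα_def, map_mul, hb, Rat.cast_neg]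
  have hβ : ∀ u, β (c * u) = -β u := fun u => by
    simp only [hβ_def, map_mul, mul_assoc, hb, Rat.cast_neg]
  -- the two-sheet system
  have hsplit := fun g => sum_eq_sum_sheets i hi x hx hcov S S₁ S₂ hS₁ hS₂ (fun s => (b (s * g) : ℂ))
  have hannC : ∀ g : G, ∑ s ∈ S, (b (s * g) : ℂ) = 0 := fun g => by exact_mod_cast hann g
  have h1 : ∀ u, ∑ s ∈ S₁, α (s * u) + ∑ t ∈ S₂, β (t * θ u) = 0 := fun u => by
    have h := hannC (i u)
    rw [hsplit] at h
    simp only [mul_assoc, hθ] at h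
    simpa only [hα_def, hβ_def, map_mul, mul_assoc] using h
  have h2 : ∀ u, ∑ s ∈ S₁, β (s * θ u) + ∑ t ∈ S₂, α (t * (q * u)) = 0 := fun u => by
    have h := hannC (x * i u)
    rw [hsplit] at h
    have e1 : ∀ s, i s * (x * i u) = i (s * θ u) * x := fun s => by rw [hθ, map_mul, mul_assoc]
    have e2 : ∀ t, i t * x * (x * i u) = i (t * (q * u)) := fun t => by
      rw [map_mul, map_mul, ← hq]; simp only [mul_assoc]
    simp only [e1, e2] at h
    simpa only [hα_def, hβ_def] using h
  obtain ⟨hα0, hβ0⟩ := twoSheet_eq_zero hcc θ hθc hθθ S₁ S₂ α β hα hβ h1 h2 hdet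
  funext g
  rcases hcov g with ⟨u, rfl⟩ | ⟨u, rfl⟩
  · have := congrFun hα0 u
    simpa [hα_def] using this
  · have := congrFun hβ0 u
    simpa [hβ_def] using this

end Group

end Literature.GroupTheory.TwoSheet

end
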